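import Mathlib.MeasureTheory.Integral.Marginal
import Mathlib.MeasureTheory.Integral.Prod
import Mathlib.MeasureTheory.Integral.Bochner.Set
import Mathlib.MeasureTheory.Measure.Haar.OfBasis
import Mathlib.Logic.Function.DependsOn
import HarnessLib

/-!
# Weakly coupled one-dimensional chains with compact spins: box marginals and conditional expectations

`Literature/Probability/LatticeModels/`. Infrastructure for the elementary (transfer-operator /
martingale) proof of the uniform Poincaré inequality and of the exponential decay of
correlations for a nearest-neighbour Gibbs measure on `[0, L]^N` at weak coupling,

  `ν(dq) = Z⁻¹ ∏_{j < N} φ_j(q) dq`,  `φ_j` depending on the coordinates `q_{j-1}, q_j` only,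
  `0 < φ₋ ≤ φ_j ≤ φ₊`

(e.g. the configurational Gibbs measure of the rotor chain of De Roeck–Huveneers at small `β`,
`φ_j = exp(-β[γ(1 - cos q_j) + (1 - cos(q_{j-1} - q_j))])`). This first file only sets up the
objects; the estimates are proved in the sibling files `WeaklyCoupledChain*.lean`.

* `BoxChain.site L` — Lebesgue measure on `[0, L]`; `BoxChain.marginal L s f` — the partial
  integral `x ↦ ∫_{[0,L]^s} f(x[y on s]) dy` of a real function over the coordinates in the finset
  `s` (a real-valued analogue of Mathlib's `MeasureTheory.lmarginal`, specialised to the box), with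
  the Fubini rule `marginal_union` for continuous integrands.
* `BoxChain.Spec N` — the data `L, (φ_j)_{j<N}, φ₋, φ₊` with their hypotheses (continuity, bounds,
  locality); `Spec.tail k = {i | k ≤ i}`; `Spec.weight k = ∏_{j ≥ k} φ_j` (the Boltzmann weight of
  the levels `≥ k`; `weight 0` is the full density); `Spec.msg k = ∫ weight k` over the tail
  coordinates (the "message"/partial partition function, a function of `q_{k-1}`);
  `Spec.condExp k h = (∫_{tail k} h · weight k) / msg k` — the conditional expectation of `h` given
  the first `k` coordinates (`condExp 0 h` is the constant `ν(h)`, `condExp k h = h` for `k ≥ N`);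
  `Spec.box`, `Spec.partitionFn`, `Spec.gibbs` — the probability measure `ν` itself.

Design: everything is a plain function on `Fin N → ℝ` (no quotient types, no sub-σ-algebras):
"measurable with respect to the first `k` coordinates" is Mathlib's `DependsOn h {i | i < k}`,
conditional expectations are explicit ratios of box marginals, and all integrands are continuous
(so every marginal is again continuous, `continuous_marginal`, and integrable on the compact box).
-/

noncomputable section

open MeasureTheory Function Set Filter
open scoped ENNReal Topology

namespace Literature.Probability.LatticeModels

namespace BoxChain

variable {N : ℕ}

/-! ### Box marginals -/

/-- Lebesgue measure on the interval `[0, L]` (the single-spin reference measure). [folklore] -/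
def site (L : ℝ) : Measure ℝ := volume.restrict (Icc 0 L)

/-- `site L` is a finite measure. [folklore] -/
instance isFiniteMeasure_site (L : ℝ) : IsFiniteMeasure (site L) := by
  unfold site; infer_instance

/-- The box marginal over the coordinates in `s`:
`marginal L s f x = ∫_{[0,L]^s} f(x with the coordinates in s replaced by y) dy`, a function of
`x` not depending on the coordinates in `s` (real-valued analogue of `MeasureTheory.lmarginal`
for the reference measure `site L`). [folklore] -/
def marginal (L : ℝ) (s : Finset (Fin N)) (f : (Fin N → ℝ) → ℝ) (x : Fin N → ℝ) : ℝ :=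
  ∫ y : (↥s → ℝ), f (updateFinset x s y) ∂(Measure.pi fun _ : ↥s => site L)

/-- The reference measure on `[0,L]^s` is Lebesgue measure restricted to the box. [folklore] -/
theorem pi_site_eq (L : ℝ) (s : Finset (Fin N)) :
    (Measure.pi fun _ : ↥s => site L) =
      (volume : Measure (↥s → ℝ)).restrict (Set.pi univ fun _ => Icc 0 L) := by
  rw [volume_pi, Measure.restrict_pi_pi]
  rfl

/-- The reference measure on `[0,L]^s` is finite. [folklore] -/
instance isFiniteMeasure_pi_site (L : ℝ) (s : Finset (Fin N)) :
    IsFiniteMeasure (Measure.pi fun _ : ↥s => site L) := by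
  infer_instance

/-- The box `[0, L]^ι` is compact. [folklore] -/
theorem isCompact_box (L : ℝ) (ι : Type*) : IsCompact (Set.pi univ fun _ : ι => Icc (0 : ℝ) L) :=
  isCompact_univ_pi fun _ => isCompact_Icc

/-- `updateFinset` is jointly continuous. [folklore] -/
theorem continuous_updateFinset (s : Finset (Fin N)) :
    Continuous fun p : (Fin N → ℝ) × (↥s → ℝ) => updateFinset p.1 s p.2 := by
  refine continuous_pi fun i => ?_
  by_cases hi : i ∈ s
  · simp only [updateFinset, dif_pos hi]
    exact (continuous_apply _).comp continuous_snd
  · simp only [updateFinset, dif_neg hi]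
    exact (continuous_apply _).comp continuous_fst

/-- A continuous integrand is integrable on the box in the integrated coordinates. [folklore] -/
theorem integrable_updateFinset {f : (Fin N → ℝ) → ℝ} (hf : Continuous f) (L : ℝ)
    (s : Finset (Fin N)) (x : Fin N → ℝ) :
    Integrable (fun y : ↥s → ℝ => f (updateFinset x s y)) (Measure.pi fun _ : ↥s => site L) := by
  rw [pi_site_eq]
  exact ((hf.comp ((continuous_updateFinset s).comp (Continuous.prodMk_right x))).continuousOn).integrableOn_compact
    (isCompact_box L _)

/-- Integrating over no coordinate does nothing. [folklore] -/
@[simp] theorem marginal_empty (L : ℝ) (f : (Fin N → ℝ) → ℝ) : marginal L ∅ f = f := by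
  funext x
  rw [marginal, Measure.pi_of_empty, integral_dirac]
  rfl

/-- The marginal does not depend on the integrated coordinates. [folklore] -/
theorem marginal_congr_of_eq_off {L : ℝ} {s : Finset (Fin N)} (f : (Fin N → ℝ) → ℝ)
    {x x' : Fin N → ℝ} (h : ∀ i ∉ s, x i = x' i) : marginal L s f x = marginal L s f x' := by
  unfold marginal
  congr 1
  funext y
  congr 1
  funext i
  by_cases hi : i ∈ s
  · simp [updateFinset, hi]
  · simp [updateFinset, hi, h i hi]

/-- As a `DependsOn` statement: `marginal L s f` depends only on the coordinates off `s`. [folklore] -/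
theorem dependsOn_marginal (L : ℝ) (s : Finset (Fin N)) (f : (Fin N → ℝ) → ℝ) :
    DependsOn (marginal L s f) {i | i ∉ s} :=
  fun _ _ h => marginal_congr_of_eq_off f fun i hi => h i hi

/-- Updating an integrated coordinate does not change the marginal. [folklore] -/
theorem marginal_update_of_mem {L : ℝ} {s : Finset (Fin N)} {i : Fin N} (hi : i ∈ s)
    (f : (Fin N → ℝ) → ℝ) (x : Fin N → ℝ) (t : ℝ) :
    marginal L s f (update x i t) = marginal L s f x :=
  marginal_congr_of_eq_off f fun j hj => by rw [update_of_ne (ne_of_mem_of_not_mem hi hj).symm]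

/-- A single marginal is an integral over `[0, L]`. [folklore] -/
theorem marginal_singleton (L : ℝ) (f : (Fin N → ℝ) → ℝ) (i : Fin N) (x : Fin N → ℝ) :
    marginal L {i} f x = ∫ t in Icc 0 L, f (update x i t) := by
  unfold marginal
  rw [← ((measurePreserving_piUnique fun _ : ↥({i} : Finset (Fin N)) => site L).symm _).integral_comp'
    (f := (MeasurableEquiv.piUnique fun _ : ↥({i} : Finset (Fin N)) => ℝ).symm)]
  simp only [site]
  congr 1
  funext t
  congr 1
  rw [updateFinset_singleton]
  rfl

/-- **Fubini for box marginals**: for continuous `f` and disjoint `s, t`,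
`marginal (s ∪ t) f = marginal s (marginal t f)`. [folklore] -/
theorem marginal_union {L : ℝ} {f : (Fin N → ℝ) → ℝ} (hf : Continuous f) {s t : Finset (Fin N)}
    (hst : Disjoint s t) : marginal L (s ∪ t) f = marginal L s (marginal L t f) := by
  funext x
  let e := MeasurableEquiv.piFinsetUnion (fun _ : Fin N => ℝ) hst
  have hpres := measurePreserving_piFinsetUnion hst (fun _ : Fin N => site L)
  calc marginal L (s ∪ t) f x
      = ∫ y : (↥s → ℝ) × (↥t → ℝ), f (updateFinset x (s ∪ t) (e y))
          ∂((Measure.pi fun _ : ↥s => site L).prod (Measure.pi fun _ : ↥t => site L)) := by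
        rw [marginal, ← hpres.integral_comp']
    _ = ∫ y : ↥s → ℝ, ∫ z : ↥t → ℝ, f (updateFinset x (s ∪ t) (e (y, z)))
          ∂(Measure.pi fun _ : ↥t => site L) ∂(Measure.pi fun _ : ↥s => site L) := by
        apply integral_prod
        have hi := integrable_updateFinset hf L (s ∪ t) x
        exact (hpres.integrable_comp_emb e.measurableEmbedding).2 hi
    _ = marginal L s (marginal L t f) x := by
        simp only [marginal]
        congr 1
        funext y
        congr 1
        funext z
        rw [updateFinset_updateFinset hst]
        rfl

/-- The same with the other order of integration. [folklore] -/
theorem marginal_union' {L : ℝ} {f : (Fin N → ℝ) → ℝ} (hf : Continuous f) {s t : Finset (Fin N)}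
    (hst : Disjoint s t) : marginal L (s ∪ t) f = marginal L t (marginal L s f) := by
  rw [Finset.union_comm, marginal_union hf hst.symm]

/-- The full marginal is the integral over the box `[0, L]^N`. [folklore] -/
theorem marginal_univ (L : ℝ) (f : (Fin N → ℝ) → ℝ) (x : Fin N → ℝ) :
    marginal L Finset.univ f x = ∫ q in Set.pi univ fun _ : Fin N => Icc 0 L, f q := by
  let e : ↥(Finset.univ : Finset (Fin N)) ≃ Fin N := Equiv.subtypeUnivEquiv Finset.mem_univ
  have hpres := measurePreserving_piCongrLeft (fun _ : Fin N => site L) e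
  have hm : (Measure.pi fun _ : Fin N => site L) =
      volume.restrict (Set.pi univ fun _ : Fin N => Icc 0 L) := by
    rw [volume_pi, Measure.restrict_pi_pi]; rfl
  rw [← hm, ← hpres.map_eq, integral_map_equiv]
  unfold marginal
  congr 1
  funext y
  congr 1
  funext i
  rw [updateFinset_def]
  simp only [Finset.mem_univ, dif_pos, MeasurableEquiv.coe_piCongrLeft]
  exact (Equiv.piCongrLeft_apply_apply (fun _ => ℝ) e y ⟨i, Finset.mem_univ i⟩).symm

/-- Box marginals of continuous functions are continuous. [folklore] -/
theorem continuous_marginal {L : ℝ} {s : Finset (Fin N)} {f : (Fin N → ℝ) → ℝ} (hf : Continuous f) :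
    Continuous (marginal L s f) := by
  have h := continuous_parametric_integral_of_continuous
    (μ := (volume : Measure (↥s → ℝ))) (f := fun x y => f (updateFinset x s y))
    (by exact hf.comp (continuous_updateFinset s)) (isCompact_box L ↥s)
  have e : marginal L s f =
      fun x => ∫ y in Set.pi univ fun _ : ↥s => Icc 0 L, f (updateFinset x s y) := by
    funext x; rw [marginal, pi_site_eq]
  rw [e]
  exact h

/-! #### Algebra of box marginals -/

section Algebra

variable {L : ℝ} {s : Finset (Fin N)}

/-- Linearity: sums. [folklore] -/
theorem marginal_add {f g : (Fin N → ℝ) → ℝ} (hf : Continuous f) (hg : Continuous g) :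
    marginal L s (f + g) = marginal L s f + marginal L s g := by
  funext x
  simp only [marginal, Pi.add_apply]
  exact integral_add (integrable_updateFinset hf L s x) (integrable_updateFinset hg L s x)

/-- Linearity: differences. [folklore] -/
theorem marginal_sub {f g : (Fin N → ℝ) → ℝ} (hf : Continuous f) (hg : Continuous g) :
    marginal L s (f - g) = marginal L s f - marginal L s g := by
  funext x
  simp only [marginal, Pi.sub_apply]
  exact integral_sub (integrable_updateFinset hf L s x) (integrable_updateFinset hg L s x)

/-- Linearity: scalars. [folklore] -/
theorem marginal_const_mul (c : ℝ) (f : (Fin N → ℝ) → ℝ) :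
    marginal L s (fun x => c * f x) = fun x => c * marginal L s f x := by
  funext x
  simp only [marginal]
  exact integral_const_mul c _

/-- **Pull-out**: a factor not depending on the integrated coordinates comes out of the
marginal. [folklore] -/
theorem marginal_mul_left {g : (Fin N → ℝ) → ℝ} (hg : DependsOn g {i | i ∉ s}) (f : (Fin N → ℝ) → ℝ) :
    marginal L s (fun x => g x * f x) = fun x => g x * marginal L s f x := by
  funext x
  simp only [marginal]
  have e : ∀ y : ↥s → ℝ, g (updateFinset x s y) = g x := fun y =>
    hg fun i hi => by simp [updateFinset, show i ∉ s from hi]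
  simp_rw [e]
  exact integral_const_mul (g x) _

/-- A function not depending on the integrated coordinates is multiplied by the volume `L^|s|`
(`0 ≤ L`). [folklore] -/
theorem marginal_of_dependsOn {g : (Fin N → ℝ) → ℝ} (hg : DependsOn g {i | i ∉ s}) (hL : 0 ≤ L) :
    marginal L s g = fun x => L ^ s.card * g x := by
  funext x
  simp only [marginal]
  have e : ∀ y : ↥s → ℝ, g (updateFinset x s y) = g x := fun y =>
    hg fun i hi => by simp [updateFinset, show i ∉ s from hi]
  simp_rw [e]
  rw [integral_const, smul_eq_mul, measureReal_def, Measure.pi_univ]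
  simp only [site, Measure.restrict_apply_univ, Real.volume_Icc, sub_zero, Finset.prod_const,
    Finset.card_univ, Fintype.card_coe]
  rw [ENNReal.toReal_pow, ENNReal.toReal_ofReal hL]

/-- Constants: `marginal s c = L^|s| c`. [folklore] -/
theorem marginal_const (c : ℝ) (hL : 0 ≤ L) :
    marginal L s (fun _ : Fin N → ℝ => c) = fun _ => L ^ s.card * c :=
  marginal_of_dependsOn (fun _ _ _ => rfl) hL

/-- Monotonicity. [folklore] -/
theorem marginal_mono {f g : (Fin N → ℝ) → ℝ} (hf : Continuous f) (hg : Continuous g)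
    (hfg : ∀ x, f x ≤ g x) (x : Fin N → ℝ) : marginal L s f x ≤ marginal L s g x :=
  integral_mono (integrable_updateFinset hf L s x) (integrable_updateFinset hg L s x) fun _ => hfg _

/-- Monotonicity, fibrewise version: only the values on the fibre through `x` matter. [folklore] -/
theorem marginal_mono_fibre {f g : (Fin N → ℝ) → ℝ} (hf : Continuous f) (hg : Continuous g)
    (x : Fin N → ℝ) (hfg : ∀ y : ↥s → ℝ, f (updateFinset x s y) ≤ g (updateFinset x s y)) :
    marginal L s f x ≤ marginal L s g x :=
  integral_mono (integrable_updateFinset hf L s x) (integrable_updateFinset hg L s x) fun y => hfg y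

/-- Monotonicity, fibrewise, between two base points. [folklore] -/
theorem marginal_mono_fibre' {f g : (Fin N → ℝ) → ℝ} (hf : Continuous f) (hg : Continuous g)
    (x x' : Fin N → ℝ) (hfg : ∀ y : ↥s → ℝ, f (updateFinset x s y) ≤ g (updateFinset x' s y)) :
    marginal L s f x ≤ marginal L s g x' :=
  integral_mono (integrable_updateFinset hf L s x) (integrable_updateFinset hg L s x') fun y => hfg y

/-- Congruence, fibrewise version. [folklore] -/
theorem marginal_congr_fibre (f g : (Fin N → ℝ) → ℝ) (x : Fin N → ℝ)
    (hfg : ∀ y : ↥s → ℝ, f (updateFinset x s y) = g (updateFinset x s y)) :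
    marginal L s f x = marginal L s g x := by
  unfold marginal
  exact integral_congr_ae (ae_of_all _ fun y => hfg y)

/-- Congruence, fibrewise, between two base points. [folklore] -/
theorem marginal_congr_fibre' (f g : (Fin N → ℝ) → ℝ) (x x' : Fin N → ℝ)
    (hfg : ∀ y : ↥s → ℝ, f (updateFinset x s y) = g (updateFinset x' s y)) :
    marginal L s f x = marginal L s g x' := by
  unfold marginal
  exact integral_congr_ae (ae_of_all _ fun y => hfg y)

/-- Nonnegativity. [folklore] -/
theorem marginal_nonneg {f : (Fin N → ℝ) → ℝ} (hf : ∀ x, 0 ≤ f x) (x : Fin N → ℝ) :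
    0 ≤ marginal L s f x :=
  integral_nonneg fun _ => hf _

/-- `|marginal f| ≤ marginal |f|`. [folklore] -/
theorem abs_marginal_le (f : (Fin N → ℝ) → ℝ) (x : Fin N → ℝ) :
    |marginal L s f x| ≤ marginal L s (fun x => |f x|) x := by
  unfold marginal
  exact abs_integral_le_integral_abs

/-- **Cauchy–Schwarz / Jensen for a weighted marginal**:
`(∫ h w)² ≤ (∫ h² w)(∫ w)` for a weight `w ≥ 0`. [folklore] -/
theorem sq_marginal_mul_le {h w : (Fin N → ℝ) → ℝ} (hh : Continuous h) (hw : Continuous w)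
    (hw0 : ∀ x, 0 ≤ w x) (x : Fin N → ℝ) :
    (marginal L s (fun x => h x * w x) x) ^ 2 ≤
      marginal L s (fun x => h x ^ 2 * w x) x * marginal L s w x := by
  set W := marginal L s w x with hW
  set I := marginal L s (fun x => h x * w x) x with hI
  set Q := marginal L s (fun x => h x ^ 2 * w x) x with hQ
  have hW0 : 0 ≤ W := marginal_nonneg hw0 x
  -- the quadratic `m ↦ ∫ (h - m)² w = Q - 2 m I + m² W` is nonnegative
  have hquad : ∀ m : ℝ, 0 ≤ Q - 2 * m * I + m ^ 2 * W := by
    intro m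
    have h0 : 0 ≤ marginal L s (fun x => (h x - m) ^ 2 * w x) x :=
      marginal_nonneg (fun x => mul_nonneg (sq_nonneg _) (hw0 x)) x
    have e : (fun x => (h x - m) ^ 2 * w x) =
        (fun x => h x ^ 2 * w x) - (fun x => (2 * m) * (h x * w x)) + fun x => m ^ 2 * w x := by
      funext x; simp only [Pi.add_apply, Pi.sub_apply]; ring
    rw [e, marginal_add (by fun_prop) (by fun_prop), marginal_sub (by fun_prop) (by fun_prop),
      marginal_const_mul, marginal_const_mul] at h0
    simp only [Pi.add_apply, Pi.sub_apply] at h0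
    rw [← hW, ← hI, ← hQ] at h0
    linarith
  rcases hW0.eq_or_lt with hW0' | hWpos
  · -- `W = 0`: then `I = 0` from the quadratic
    rw [← hW0', mul_zero]
    have hI0 : I = 0 := by
      by_contra hne
      have h1 := hquad ((Q + 1) / (2 * I))
      rw [← hW0'] at h1
      have : 2 * ((Q + 1) / (2 * I)) * I = Q + 1 := by field_simp
      nlinarith
    rw [hI0]; norm_num
  · have h1 := hquad (I / W)
    have e : Q - 2 * (I / W) * I + (I / W) ^ 2 * W = Q - I ^ 2 / W := by
      field_simp; ring
    rw [e] at h1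
    have h2 : I ^ 2 / W ≤ Q := by linarith
    rwa [div_le_iff₀ hWpos] at h2

end Algebra

/-! ### The chain: weights, messages, conditional expectations -/

/-- The data of a weakly coupled chain on `[0, L]^N`: step factors `φ_j`, `j < N`, continuous,
pinched between the positive constants `φ₋ ≤ φ₊`, with `φ_j` depending on the coordinates
`j - 1` and `j` only (nearest-neighbour transfer weights; `φ_0` depends on `q_0` alone). The
associated (unnormalised) Gibbs density is `∏_j φ_j`. [folklore] -/
structure Spec (N : ℕ) where
  /-- side of the box -/
  L : ℝ
  /-- the step factors -/
  φ : Fin N → (Fin N → ℝ) → ℝ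
  /-- uniform lower bound of the step factors -/
  φlo : ℝ
  /-- uniform upper bound of the step factors -/
  φhi : ℝ
  L_pos : 0 < L
  φlo_pos : 0 < φlo
  φlo_le : ∀ j q, φlo ≤ φ j q
  le_φhi : ∀ j q, φ j q ≤ φhi
  continuous_φ : ∀ j, Continuous (φ j)
  dependsOn_φ : ∀ j : Fin N, DependsOn (φ j) {i : Fin N | i.val + 1 = j.val ∨ i = j}

namespace Spec

variable (S : Spec N)

/-- The tail `{i | k ≤ i}` of coordinates not among the first `k`. [folklore] -/
def tail (k : ℕ) : Finset (Fin N) := Finset.univ.filter fun i : Fin N => k ≤ i.val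

/-- The weight of the levels `≥ k`: `W_k = ∏_{j ≥ k} φ_j` (`W_0` is the full Gibbs density,
`W_k = 1` for `k ≥ N`). [folklore] -/
def weight (k : ℕ) (q : Fin N → ℝ) : ℝ := ∏ j ∈ tail (N := N) k, S.φ j q

/-- The message `R_k = ∫_{tail k} W_k`, a function of the coordinate `q_{k-1}` alone
(`R_0 = Z`, the partition function; `R_k = 1` for `k ≥ N`). [folklore] -/
def msg (k : ℕ) : (Fin N → ℝ) → ℝ := marginal S.L (tail k) (S.weight k)

/-- The conditional expectation given the first `k` coordinates:
`E_k h = (∫_{tail k} h W_k) / R_k`, an explicit version of `ν[h | q_0, …, q_{k-1}]` for the Gibbs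
measure `ν ∝ W_0 dq` (`E_0 h = ν(h)`, `E_k h = h` for `k ≥ N`). [folklore] -/
def condExp (k : ℕ) (h : (Fin N → ℝ) → ℝ) (q : Fin N → ℝ) : ℝ :=
  marginal S.L (tail k) (fun p => h p * S.weight k p) q / S.msg k q

/-- The box `[0, L]^N`. [folklore] -/
def box : Set (Fin N → ℝ) := Set.pi univ fun _ => Icc 0 S.L

/-- The partition function `Z = ∫_{[0,L]^N} W_0`. [folklore] -/
def partitionFn : ℝ := ∫ q in S.box, S.weight 0 q

/-- The Gibbs probability measure `ν = Z⁻¹ W_0 dq` on the box. [folklore] -/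
def gibbs : Measure (Fin N → ℝ) :=
  (ENNReal.ofReal S.partitionFn)⁻¹ •
    (volume.restrict S.box).withDensity fun q => ENNReal.ofReal (S.weight 0 q)

/-! #### Tails -/

/-- Membership in the tail. [folklore] -/
@[simp] theorem mem_tail {k : ℕ} {i : Fin N} : i ∈ tail (N := N) k ↔ k ≤ i.val := by
  simp [tail]

/-- `tail 0` is everything. [folklore] -/
theorem tail_zero : tail (N := N) 0 = Finset.univ := by
  ext i; simp

/-- `tail k = ∅` for `k ≥ N`. [folklore] -/
theorem tail_eq_empty {k : ℕ} (hk : N ≤ k) : tail (N := N) k = ∅ := by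
  ext i; simp only [mem_tail, Finset.notMem_empty, iff_false, not_le]; omega

/-- `tail k = {k} ∪ tail (k+1)` for `k < N`. [folklore] -/
theorem tail_eq_union {k : ℕ} (hk : k < N) :
    tail (N := N) k = {(⟨k, hk⟩ : Fin N)} ∪ tail (N := N) (k + 1) := by
  ext i
  simp only [mem_tail, Finset.mem_union, Finset.mem_singleton, Fin.ext_iff]
  omega

/-- `{k}` and `tail (k+1)` are disjoint. [folklore] -/
theorem disjoint_singleton_tail {k : ℕ} (hk : k < N) :
    Disjoint ({(⟨k, hk⟩ : Fin N)} : Finset (Fin N)) (tail (N := N) (k + 1)) := by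
  rw [Finset.disjoint_singleton_left, mem_tail]
  simp

/-- The complement of `tail k` is the set of the first `k` coordinates. [folklore] -/
theorem not_mem_tail_iff {k : ℕ} {i : Fin N} : i ∉ tail (N := N) k ↔ i.val < k := by
  simp

/-! #### Weights -/

/-- The weights are positive. [folklore] -/
theorem weight_pos (k : ℕ) (q : Fin N → ℝ) : 0 < S.weight k q :=
  Finset.prod_pos fun j _ => S.φlo_pos.trans_le (S.φlo_le j q)

/-- The weights are continuous. [folklore] -/
theorem continuous_weight (k : ℕ) : Continuous (S.weight k) :=
  continuous_finsetProd _ fun j _ => S.continuous_φ j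

/-- `W_k = 1` for `k ≥ N`. [folklore] -/
theorem weight_of_le {k : ℕ} (hk : N ≤ k) : S.weight k = fun _ => 1 := by
  funext q; simp [weight, tail_eq_empty hk]

/-- **`W_k = φ_k W_{k+1}`** for `k < N`. [folklore] -/
theorem weight_succ {k : ℕ} (hk : k < N) (q : Fin N → ℝ) :
    S.weight k q = S.φ ⟨k, hk⟩ q * S.weight (k + 1) q := by
  simp only [weight]
  rw [tail_eq_union hk, Finset.prod_union (disjoint_singleton_tail hk), Finset.prod_singleton]

/-- `W_k` depends only on the coordinates `≥ k - 1`. [folklore] -/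
theorem dependsOn_weight (k : ℕ) : DependsOn (S.weight k) {i : Fin N | k ≤ i.val + 1} := by
  intro q q' h
  simp only [weight]
  refine Finset.prod_congr rfl fun j hj => S.dependsOn_φ j fun i hi => h i ?_
  simp only [mem_tail] at hj
  simp only [Set.mem_setOf_eq] at hi ⊢
  rcases hi with hi | hi
  · omega
  · rw [hi]; omega

/-- `φ_k` does not depend on the coordinates in `tail (k+1)`. [folklore] -/
theorem dependsOn_φ_compl_tail {k : ℕ} (hk : k < N) :
    DependsOn (S.φ ⟨k, hk⟩) {i : Fin N | i ∉ tail (N := N) (k + 1)} := by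
  intro q q' h
  refine S.dependsOn_φ ⟨k, hk⟩ fun i hi => h i ?_
  simp only [Set.mem_setOf_eq, mem_tail, not_le] at hi ⊢
  rcases hi with hi | hi
  · have hi' : i.val + 1 = k := hi
    omega
  · rw [hi]; simp

/-- The ratio `ρ₀ = φ₊/φ₋ ≥ 1` of the bounds of the step factors. [folklore] -/
def ratio : ℝ := S.φhi / S.φlo

/-- `φ₋ ≤ φ₊`, from any step factor (`N ≥ 1`); in general `0 < φ₋`. [folklore] -/
theorem one_le_ratio (hN : 0 < N) : 1 ≤ S.ratio := by
  rw [ratio, one_le_div S.φlo_pos]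
  exact (S.φlo_le ⟨0, hN⟩ 0).trans (S.le_φhi ⟨0, hN⟩ 0)

/-- Changing one coordinate changes a step factor by at most the factor `ρ₀`. [folklore] -/
theorem φ_le_ratio_mul (j : Fin N) (p p' : Fin N → ℝ) : S.φ j p ≤ S.ratio * S.φ j p' := by
  rw [ratio, div_mul_eq_mul_div, le_div_iff₀ S.φlo_pos]
  exact mul_le_mul (S.le_φhi j p) (S.φlo_le j p') S.φlo_pos.le
    (S.φlo_pos.le.trans ((S.φlo_le j p).trans (S.le_φhi j p)))

/-- **Changing one coordinate changes `W_k` by at most `ρ₀²`**: at most the two factors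
`φ_i, φ_{i+1}` see the coordinate `i`. [folklore] -/
theorem weight_le_sq_ratio_mul_weight_update (k : ℕ) (i : Fin N) (p : Fin N → ℝ) (r : ℝ) :
    S.weight k p ≤ S.ratio ^ 2 * S.weight k (update p i r) := by
  classical
  have hN : 0 < N := Fin.pos i
  have hρ : 1 ≤ S.ratio := S.one_le_ratio hN
  -- the factors seeing the coordinate `i`
  set A := (tail (N := N) k).filter fun j : Fin N => j = i ∨ j.val = i.val + 1 with hA
  set B := (tail (N := N) k).filter fun j : Fin N => ¬(j = i ∨ j.val = i.val + 1) with hB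
  have hsplit : ∀ x : Fin N → ℝ, S.weight k x = (∏ j ∈ A, S.φ j x) * ∏ j ∈ B, S.φ j x := by
    intro x
    rw [weight, ← Finset.prod_filter_mul_prod_filter_not (tail k) (fun j : Fin N => j = i ∨ j.val = i.val + 1)]
  have hBeq : ∏ j ∈ B, S.φ j p = ∏ j ∈ B, S.φ j (update p i r) := by
    refine Finset.prod_congr rfl fun j hj => S.dependsOn_φ j fun l hl => ?_
    simp only [hB, Finset.mem_filter, not_or] at hj
    simp only [Set.mem_setOf_eq] at hl
    have hli : l ≠ i := by
      rintro rfl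
      rcases hl with hl | hl
      · exact hj.2.2 hl.symm
      · exact hj.2.1 hl.symm
    rw [update_of_ne hli]
  have hAcard : A.card ≤ 2 := by
    have hsub : A ⊆ ({i} : Finset (Fin N)) ∪ (Finset.univ.filter fun j : Fin N => j.val = i.val + 1) := by
      intro j hj
      simp only [hA, Finset.mem_filter] at hj
      rcases hj.2 with h | h
      · simp [h]
      · simp [h]
    have hc2 : (Finset.univ.filter fun j : Fin N => j.val = i.val + 1).card ≤ 1 :=
      Finset.card_le_one.2 fun a ha b hb => Fin.ext (by
        simp only [Finset.mem_filter] at ha hb; omega)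
    calc A.card ≤ (({i} : Finset (Fin N)) ∪ (Finset.univ.filter fun j : Fin N => j.val = i.val + 1)).card :=
          Finset.card_le_card hsub
      _ ≤ ({i} : Finset (Fin N)).card + (Finset.univ.filter fun j : Fin N => j.val = i.val + 1).card :=
          Finset.card_union_le _ _
      _ ≤ 2 := by rw [Finset.card_singleton]; omega
  have hAle : ∏ j ∈ A, S.φ j p ≤ S.ratio ^ 2 * ∏ j ∈ A, S.φ j (update p i r) := by
    calc ∏ j ∈ A, S.φ j p ≤ ∏ j ∈ A, S.ratio * S.φ j (update p i r) :=
          Finset.prod_le_prod (fun j _ => S.φlo_pos.le.trans (S.φlo_le j p))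
            fun j _ => S.φ_le_ratio_mul j p _
      _ = S.ratio ^ A.card * ∏ j ∈ A, S.φ j (update p i r) := by
          rw [Finset.prod_mul_distrib, Finset.prod_const]
      _ ≤ S.ratio ^ 2 * ∏ j ∈ A, S.φ j (update p i r) := by
          refine mul_le_mul_of_nonneg_right (pow_le_pow_right₀ hρ hAcard) ?_
          exact Finset.prod_nonneg fun j _ => S.φlo_pos.le.trans (S.φlo_le j _)
  rw [hsplit p, hsplit (update p i r), hBeq, ← mul_assoc]
  exact mul_le_mul_of_nonneg_right hAle
    (Finset.prod_nonneg fun j _ => S.φlo_pos.le.trans (S.φlo_le j _))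

/-! #### Messages -/

/-- The messages are continuous. [folklore] -/
theorem continuous_msg (k : ℕ) : Continuous (S.msg k) :=
  continuous_marginal (S.continuous_weight k)

/-- `R_k = 1` for `k ≥ N`. [folklore] -/
theorem msg_of_le {k : ℕ} (hk : N ≤ k) : S.msg k = fun _ => 1 := by
  funext q
  simp [msg, tail_eq_empty hk, S.weight_of_le hk]

/-- Lower bound `R_k ≥ (L φ₋)^{|tail k|} > 0`. [folklore] -/
theorem pow_le_msg (k : ℕ) (q : Fin N → ℝ) :
    (S.L * S.φlo) ^ (tail (N := N) k).card ≤ S.msg k q := by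
  have h1 : marginal S.L (tail k) (fun _ : Fin N → ℝ => S.φlo ^ (tail (N := N) k).card) q ≤
      S.msg k q :=
    marginal_mono continuous_const (S.continuous_weight k) (fun x => by
      simp only [weight]
      calc S.φlo ^ (tail (N := N) k).card = ∏ _j ∈ tail (N := N) k, S.φlo := by
            rw [Finset.prod_const]
        _ ≤ _ := Finset.prod_le_prod (fun _ _ => S.φlo_pos.le) fun j _ => S.φlo_le j x) q
  rw [marginal_const _ S.L_pos.le] at h1
  simpa [mul_pow] using h1

/-- The messages are positive. [folklore] -/
theorem msg_pos (k : ℕ) (q : Fin N → ℝ) : 0 < S.msg k q :=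
  (pow_pos (mul_pos S.L_pos S.φlo_pos) _).trans_le (S.pow_le_msg k q)

/-- `R_k` depends only on the coordinate `k - 1` (on nothing if `k = 0`). [folklore] -/
theorem dependsOn_msg (k : ℕ) : DependsOn (S.msg k) {i : Fin N | i.val + 1 = k} := by
  intro q q' h
  -- pass through the configuration agreeing with `q` on the tail and with `q'` off it
  have h1 : S.msg k q = S.msg k (fun i => if i ∈ tail (N := N) k then q i else q' i) := by
    unfold msg marginal
    congr 1
    funext y
    apply S.dependsOn_weight k
    intro i hi
    simp only [Set.mem_setOf_eq] at hi
    by_cases hit : i ∈ tail (N := N) k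
    · simp [updateFinset, hit]
    · simp only [updateFinset, dif_neg hit, if_neg hit]
      have : i.val + 1 = k := by simp at hit; omega
      exact h i this
  rw [h1]
  exact marginal_congr_of_eq_off _ fun i hi => by simp [hi]

/-! #### Conditional expectations: first properties -/

/-- `E_k h = h` for `k ≥ N` (nothing to integrate). [folklore] -/
theorem condExp_of_le {k : ℕ} (hk : N ≤ k) (h : (Fin N → ℝ) → ℝ) : S.condExp k h = h := by
  funext q
  simp [condExp, tail_eq_empty hk, S.weight_of_le hk, S.msg_of_le hk]

/-- `E_k 1 = 1`. [folklore] -/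
theorem condExp_one (k : ℕ) : S.condExp k (fun _ => 1) = fun _ => 1 := by
  funext q
  simp only [condExp, one_mul]
  exact div_self (S.msg_pos k q).ne'

/-- `E_k h` depends only on the first `k` coordinates. [folklore] -/
theorem dependsOn_condExp (k : ℕ) (h : (Fin N → ℝ) → ℝ) :
    DependsOn (S.condExp k h) {i : Fin N | i.val < k} := by
  intro q q' hqq'
  simp only [condExp]
  have hoff : ∀ i ∉ tail (N := N) k, q i = q' i := fun i hi => hqq' i (by simpa using hi)
  rw [marginal_congr_of_eq_off _ hoff]
  congr 1
  exact marginal_congr_of_eq_off _ hoff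

/-- `E_k h` is continuous for continuous `h`. [folklore] -/
theorem continuous_condExp (k : ℕ) {h : (Fin N → ℝ) → ℝ} (hh : Continuous h) :
    Continuous (S.condExp k h) :=
  (continuous_marginal (hh.mul (S.continuous_weight k))).div (S.continuous_msg k)
    fun q => (S.msg_pos k q).ne'

/-- Linearity of `E_k`: sums. [folklore] -/
theorem condExp_add (k : ℕ) {f g : (Fin N → ℝ) → ℝ} (hf : Continuous f) (hg : Continuous g) :
    S.condExp k (f + g) = S.condExp k f + S.condExp k g := by
  funext q
  simp only [condExp, Pi.add_apply]
  rw [← add_div]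
  congr 1
  have e : (fun p => (f p + g p) * S.weight k p) =
      (fun p => f p * S.weight k p) + fun p => g p * S.weight k p := by
    funext p; simp only [Pi.add_apply]; ring
  rw [e, marginal_add (f := fun p => f p * S.weight k p) (g := fun p => g p * S.weight k p)
    (hf.mul (S.continuous_weight k)) (hg.mul (S.continuous_weight k))]
  rfl

/-- Linearity of `E_k`: differences. [folklore] -/
theorem condExp_sub (k : ℕ) {f g : (Fin N → ℝ) → ℝ} (hf : Continuous f) (hg : Continuous g) :
    S.condExp k (f - g) = S.condExp k f - S.condExp k g := by
  funext q
  simp only [condExp, Pi.sub_apply]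
  rw [← sub_div]
  congr 1
  have e : (fun p => (f p - g p) * S.weight k p) =
      (fun p => f p * S.weight k p) - fun p => g p * S.weight k p := by
    funext p; simp only [Pi.sub_apply]; ring
  rw [e, marginal_sub (f := fun p => f p * S.weight k p) (g := fun p => g p * S.weight k p)
    (hf.mul (S.continuous_weight k)) (hg.mul (S.continuous_weight k))]
  rfl

/-- **Pull-out**: a factor depending only on the first `k` coordinates comes out of `E_k`. [folklore] -/
theorem condExp_mul_left (k : ℕ) {g : (Fin N → ℝ) → ℝ} (hg : DependsOn g {i : Fin N | i.val < k})
    (h : (Fin N → ℝ) → ℝ) : S.condExp k (fun p => g p * h p) = fun p => g p * S.condExp k h p := by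
  funext q
  simp only [condExp]
  have hg' : DependsOn g {i : Fin N | i ∉ tail (N := N) k} := hg.mono fun i hi => by simpa using hi
  have e : (fun p => g p * h p * S.weight k p) = fun p => g p * (h p * S.weight k p) := by
    funext p; ring
  rw [e, marginal_mul_left hg']
  ring

/-- A function of the first `k` coordinates is fixed by `E_k`. [folklore] -/
theorem condExp_of_dependsOn (k : ℕ) {g : (Fin N → ℝ) → ℝ} (hg : DependsOn g {i : Fin N | i.val < k}) :
    S.condExp k g = g := by
  have h := S.condExp_mul_left k hg (fun _ => 1)
  simp only [mul_one] at h
  rw [h, S.condExp_one]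
  funext p; simp

/-- Constants are fixed by `E_k`. [folklore] -/
theorem condExp_const (k : ℕ) (c : ℝ) : S.condExp k (fun _ => c) = fun _ => c :=
  S.condExp_of_dependsOn k fun _ _ _ => rfl

/-- Monotonicity of `E_k`, fibrewise: only the values of `h ≤ h'` on the tail fibre matter. [folklore] -/
theorem condExp_mono_fibre (k : ℕ) {h h' : (Fin N → ℝ) → ℝ} (hh : Continuous h) (hh' : Continuous h')
    (q : Fin N → ℝ)
    (hle : ∀ y : ↥(tail (N := N) k) → ℝ, h (updateFinset q (tail k) y) ≤ h' (updateFinset q (tail k) y)) :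
    S.condExp k h q ≤ S.condExp k h' q := by
  simp only [condExp]
  refine div_le_div_of_nonneg_right ?_ (S.msg_pos k q).le
  exact marginal_mono_fibre (hh.mul (S.continuous_weight k)) (hh'.mul (S.continuous_weight k)) q
    fun y => mul_le_mul_of_nonneg_right (hle y) (S.weight_pos k _).le

/-- Monotonicity of `E_k`. [folklore] -/
theorem condExp_mono (k : ℕ) {h h' : (Fin N → ℝ) → ℝ} (hh : Continuous h) (hh' : Continuous h')
    (hle : ∀ p, h p ≤ h' p) (q : Fin N → ℝ) : S.condExp k h q ≤ S.condExp k h' q :=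
  S.condExp_mono_fibre k hh hh' q fun _ => hle _

/-- Congruence of `E_k`, fibrewise. [folklore] -/
theorem condExp_congr_fibre (k : ℕ) (h h' : (Fin N → ℝ) → ℝ) (q : Fin N → ℝ)
    (heq : ∀ y : ↥(tail (N := N) k) → ℝ, h (updateFinset q (tail k) y) = h' (updateFinset q (tail k) y)) :
    S.condExp k h q = S.condExp k h' q := by
  simp only [condExp]
  rw [marginal_congr_fibre (fun p => h p * S.weight k p) (fun p => h' p * S.weight k p) q
    fun y => by rw [heq y]]

/-- `E_k` of a nonnegative function is nonnegative. [folklore] -/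
theorem condExp_nonneg (k : ℕ) {h : (Fin N → ℝ) → ℝ} (hh : ∀ p, 0 ≤ h p) (q : Fin N → ℝ) :
    0 ≤ S.condExp k h q :=
  div_nonneg (marginal_nonneg (fun p => mul_nonneg (hh p) (S.weight_pos k p).le) q) (S.msg_pos k q).le

/-- `|E_k h| ≤ E_k |h|`. [folklore] -/
theorem abs_condExp_le (k : ℕ) (h : (Fin N → ℝ) → ℝ) (q : Fin N → ℝ) :
    |S.condExp k h q| ≤ S.condExp k (fun p => |h p|) q := by
  simp only [condExp, abs_div, abs_of_pos (S.msg_pos k q)]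
  refine div_le_div_of_nonneg_right ?_ (S.msg_pos k q).le
  refine (abs_marginal_le _ q).trans (le_of_eq ?_)
  congr 1
  funext p
  rw [abs_mul, abs_of_pos (S.weight_pos k p)]

/-- **Conditional Jensen / Cauchy–Schwarz**: `(E_k h)² ≤ E_k (h²)`. [folklore] -/
theorem sq_condExp_le (k : ℕ) {h : (Fin N → ℝ) → ℝ} (hh : Continuous h) (q : Fin N → ℝ) :
    S.condExp k h q ^ 2 ≤ S.condExp k (fun p => h p ^ 2) q := by
  simp only [condExp]
  have hcs := sq_marginal_mul_le (s := tail k) (L := S.L) hh (S.continuous_weight k)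
    (fun p => (S.weight_pos k p).le) q
  have hR := S.msg_pos k q
  rw [div_pow, div_le_div_iff₀ (pow_pos hR 2) hR]
  calc (marginal S.L (tail k) (fun x => h x * S.weight k x) q) ^ 2 * S.msg k q
      ≤ (marginal S.L (tail k) (fun x => h x ^ 2 * S.weight k x) q * S.msg k q) * S.msg k q :=
        mul_le_mul_of_nonneg_right hcs hR.le
    _ = _ := by rw [msg]; ring

end Spec

end BoxChain

end Literature.Probability.LatticeModels

end
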